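import Summits.MatrixMultiplication.MatrixMultiplication.Theorems.SoloInformedTwistedMatchingsCyclic
import Mathlib.NumberTheory.Bertrand
import HarnessLib

/-!
# `δ_p → 0` is forced: prime cyclic hosts (Theorem B″, clause (b): characteristic `→ ∞`)

Solo-informed seat (MatrixMultiplication), gen 101; sharpest-statement §2y(8), clauses (b), (d).
Theorem B″'s saving `δ` depends on the exponent, in particular on the characteristic `p` of an
elementary abelian host, and tends to `0` as `p → ∞`. This is not an artefact: already the prime
fields `𝔽_P` themselves (dimension one) carry untwisted matchings `x·y·z = 1 ⟺ i = j = l` of size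
`r₃(N)` whenever `2N ≤ P` (`threeAPFree_matching_zmod`), so by Bertrand and Behrend there is no
`δ > 0` with `|ι| ≤ 3 P^{1-δ}` for all primes `P` (`not_prime_matching_bound`); a fortiori none over
all elementary abelian hosts `𝔽_P^k`, `P` unbounded. Together with `not_cyclic_matching_bound`:
the slice-rank route to excluding translation schemes (B″) covers exactly the hosts of bounded
exponent, and within reach of this method the regimes "characteristic `→ ∞`" and "`ℤ/p^k`, `k → ∞`"
of Cohn–Umans 2013 §5 stay open.
References: Behrend (1946); Bertrand–Chebyshev (Mathlib `Nat.exists_prime_lt_and_le_two_mul`);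
CohnUmans2013 (arXiv:1207.6528) §5; BCCGNSU17 (arXiv:1605.06702) §1.
-/

noncomputable section

open scoped BigOperators
open Finset

namespace Summit.MatrixMultiplication.MatrixMultiplication.Theorems.TwistedSliceRank

section PrimeHost

/-- A 3-AP-free `t ⊆ [0,N)` is an untwisted matching `x_a = y_a = a`, `z_a = -2a` in `ℤ/P` for
every `P ≥ 2N`. [folklore] -/
theorem threeAPFree_matching_zmod (N : ℕ) {t : Finset ℕ} (ht : ThreeAPFree (t : Set ℕ))
    (htN : t ⊆ Finset.range N) (P : ℕ) [NeZero P] (hP : 2 * N ≤ P) :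
    ∃ (x y z : ↥t → Multiplicative (ZMod P)),
      ∀ i j l : ↥t, (x i * y j * z l = 1) ↔ (i = j ∧ j = l) := by
  refine ⟨fun i => Multiplicative.ofAdd (((i : ℕ) : ZMod P)),
    fun i => Multiplicative.ofAdd (((i : ℕ) : ZMod P)),
    fun i => Multiplicative.ofAdd (-(2 * ((i : ℕ) : ZMod P))), fun i j l => ?_⟩
  have hi : (i : ℕ) < N := Finset.mem_range.1 (htN i.2)
  have hj : (j : ℕ) < N := Finset.mem_range.1 (htN j.2)
  have hl : (l : ℕ) < N := Finset.mem_range.1 (htN l.2)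
  have hPr : (2 * N : ℤ) ≤ (P : ℤ) := by exact_mod_cast hP
  rw [← ofAdd_add, ← ofAdd_add, ofAdd_eq_one]
  constructor
  · intro h
    have hX : ((((i : ℕ) : ℤ) + ((j : ℕ) : ℤ) - 2 * ((l : ℕ) : ℤ) : ℤ) : ZMod P) = 0 := by
      push_cast; rw [← h]; ring
    rw [ZMod.intCast_zmod_eq_zero_iff_dvd] at hX
    have hX0 : ((i : ℕ) : ℤ) + ((j : ℕ) : ℤ) - 2 * ((l : ℕ) : ℤ) = 0 :=
      Int.eq_zero_of_abs_lt_dvd hX (by rw [abs_lt]; constructor <;> linarith)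
    have h3 : (i : ℕ) + (j : ℕ) = (l : ℕ) + (l : ℕ) := by omega
    have hil : (i : ℕ) = (l : ℕ) := ht i.2 l.2 j.2 h3
    have hjl : (j : ℕ) = (l : ℕ) := by omega
    exact ⟨Subtype.ext (hil.trans hjl.symm), Subtype.ext hjl⟩
  · rintro ⟨rfl, rfl⟩
    ring

/-- **No uniform power saving over prime fields.** There is no `δ > 0` such that every matching
`x_i y_j z_l = 1 ⟺ i = j = l` in every `𝔽_P`, `P` prime, has `≤ 3 P^{1-δ}` elements: for
`log N ≥ (5/δ+1)²` and a prime `2N < P ≤ 4N` (Bertrand), `r₃(N) ≥ N e^{-4√(log N)} > 12 N^{1-δ}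
≥ 3 P^{1-δ}`. Hence `δ_p → 0` in Theorem B″ is forced. [this work] -/
theorem not_prime_matching_bound :
    ¬ ∃ δ : ℝ, 0 < δ ∧ ∀ (P : ℕ) [NeZero P], P.Prime → ∀ (ι : Type) [Fintype ι]
        (x y z : ι → Multiplicative (ZMod P)),
        (∀ i j l : ι, (x i * y j * z l = 1) ↔ (i = j ∧ j = l)) →
        (Fintype.card ι : ℝ) ≤ 3 * (P : ℝ) ^ (1 - δ) := by
  rintro ⟨δ, hδ, hB⟩
  -- the parameter
  set t₀ : ℝ := 5 / δ + 1 with ht₀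
  have ht₀0 : 0 < t₀ := by rw [ht₀]; positivity
  set N : ℕ := ⌈Real.exp (t₀ ^ 2)⌉₊ with hNdef
  have hNexp : Real.exp (t₀ ^ 2) ≤ (N : ℝ) := Nat.le_ceil _
  have hN1 : (1 : ℝ) ≤ N := le_trans (by linarith [Real.add_one_le_exp (t₀ ^ 2), sq_nonneg t₀]) hNexp
  have hN0 : (0 : ℝ) < N := by linarith
  have hNpos : 0 < N := by exact_mod_cast hN0
  -- a prime `2N < P ≤ 4N` and the matching of size `r₃(N)` in `ℤ/P`
  obtain ⟨P, hP, h2NP, hP4N⟩ := Nat.exists_prime_lt_and_le_two_mul (2 * N) (by omega)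
  haveI : NeZero P := ⟨hP.ne_zero⟩
  obtain ⟨t, htN, htcard, ht⟩ := rothNumberNat_spec N
  obtain ⟨x, y, z, hm⟩ := threeAPFree_matching_zmod N ht htN P h2NP.le
  have h1 := hB P hP ↥t x y z hm
  rw [Fintype.card_coe, htcard] at h1
  have hP0 : (0 : ℝ) < P := by exact_mod_cast hP.pos
  have hNP : (N : ℝ) ≤ P := by exact_mod_cast (show N ≤ P by omega)
  have hP4 : (P : ℝ) ≤ 4 * N := by exact_mod_cast (show P ≤ 4 * N by omega)
  -- `3 P^{1-δ} ≤ 12 N^{1-δ}`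
  have h2 : (P : ℝ) ^ (1 - δ) ≤ 4 * (N : ℝ) ^ (1 - δ) := by
    rw [Real.rpow_sub hP0, Real.rpow_one, Real.rpow_sub hN0, Real.rpow_one]
    rw [div_eq_mul_inv, div_eq_mul_inv, ← mul_assoc]
    refine mul_le_mul hP4 ?_ (inv_nonneg.2 (Real.rpow_nonneg hP0.le _)) (by positivity)
    exact inv_anti₀ (Real.rpow_pos_of_pos hN0 _) (Real.rpow_le_rpow hN0.le hNP hδ.le)
  -- upper bound: `N^δ e^{-4√log N} < 12`... indeed `≤ 12`, and we show `> 12` below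
  have hBeh : (N : ℝ) * Real.exp (-4 * Real.sqrt (Real.log N)) ≤ (rothNumberNat N : ℝ) :=
    Behrend.roth_lower_bound
  have hsplit : (N : ℝ) = (N : ℝ) ^ (1 - δ) * (N : ℝ) ^ δ := by
    rw [← Real.rpow_add hN0, sub_add_cancel, Real.rpow_one]
  have hupper : (N : ℝ) ^ δ * Real.exp (-4 * Real.sqrt (Real.log N)) ≤ 12 := by
    have h3 : (N : ℝ) ^ (1 - δ) * ((N : ℝ) ^ δ * Real.exp (-4 * Real.sqrt (Real.log N))) ≤
        (N : ℝ) ^ (1 - δ) * 12 := by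
      calc (N : ℝ) ^ (1 - δ) * ((N : ℝ) ^ δ * Real.exp (-4 * Real.sqrt (Real.log N)))
          = (N : ℝ) * Real.exp (-4 * Real.sqrt (Real.log N)) := by rw [← mul_assoc, ← hsplit]
        _ ≤ 3 * (P : ℝ) ^ (1 - δ) := hBeh.trans h1
        _ ≤ 3 * (4 * (N : ℝ) ^ (1 - δ)) := by linarith
        _ = (N : ℝ) ^ (1 - δ) * 12 := by ring
    exact le_of_mul_le_mul_left h3 (Real.rpow_pos_of_pos hN0 _)
  -- lower bound: `N^δ e^{-4√log N} = exp(δ log N - 4 √log N) ≥ exp 6 ≥ 16`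
  have hu : t₀ ^ 2 ≤ Real.log N := by
    have h := Real.log_le_log (Real.exp_pos _) hNexp
    rwa [Real.log_exp] at h
  have hu0 : 0 ≤ Real.log N := le_trans (sq_nonneg _) hu
  set s : ℝ := Real.sqrt (Real.log N) with hs
  have hst : t₀ ≤ s := by
    rw [hs, ← Real.sqrt_sq ht₀0.le]
    exact Real.sqrt_le_sqrt hu
  have hs0 : 0 ≤ s := ht₀0.le.trans hst
  have hss : s ^ 2 = Real.log N := by rw [hs]; exact Real.sq_sqrt hu0
  have hδt : δ * t₀ = 5 + δ := by rw [ht₀]; field_simp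
  have hδs : 5 + δ ≤ δ * s := by rw [← hδt]; exact mul_le_mul_of_nonneg_left hst hδ.le
  have hexp6 : (6 : ℝ) ≤ δ * Real.log N - 4 * s := by
    have h4 : t₀ * (1 + δ) ≤ s * (δ * s - 4) :=
      mul_le_mul hst (by linarith) (by linarith) hs0
    have h5 : (6 : ℝ) ≤ t₀ * (1 + δ) := by
      have h6 : t₀ * (1 + δ) = 6 + 5 / δ + δ := by rw [ht₀]; field_simp; ring
      rw [h6]
      have : (0 : ℝ) < 5 / δ := by positivity
      linarith
    calc (6 : ℝ) ≤ s * (δ * s - 4) := h5.trans h4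
      _ = δ * s ^ 2 - 4 * s := by ring
      _ = δ * Real.log N - 4 * s := by rw [hss]
  have hlower : (12 : ℝ) < (N : ℝ) ^ δ * Real.exp (-4 * Real.sqrt (Real.log N)) := by
    rw [Real.rpow_def_of_pos hN0, ← Real.exp_add, ← hs]
    have h7 : (12 : ℝ) < Real.exp 6 := by
      rw [show (6 : ℝ) = 3 + 3 by norm_num, Real.exp_add]
      nlinarith [Real.add_one_le_exp (3 : ℝ)]
    refine h7.trans_le (Real.exp_le_exp.2 ?_)
    linarith
  linarith

end PrimeHost

end Summit.MatrixMultiplication.MatrixMultiplication.Theorems.TwistedSliceRank
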